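import Literature.MathematicalPhysics.QuantumFieldTheory.Balaban1983to89.B7Eq122LinearPartIsLinear
import Literature.MathematicalPhysics.QuantumFieldTheory.Balaban1983to89.B7Prop4GeneralLevels
import Literature.MathematicalPhysics.QuantumFieldTheory.Balaban1983to89.B9Eq326OperatorAssembly

/-!
# `Balaban1983to89.B9Eq315QTorus` — T. Bałaban, *Propagators for lattice gauge theories in a background field*, Commun. Math. Phys. **99** (1985)
# 389–434 [Balaban1985BackgroundPropagators] (3.13)–(3.15) p. 393, with [Balaban1985Averaging] (121)–(127) pp. 36–37 and (1) p. 17: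
# THE ONE-STEP VECTOR AVERAGING `Q(U)` ON THE PERIODIC LATTICE — the `ℤ^d` linear map `B7Eq122LinearPartIsLinear.linQAt` read through the
# PERIODIC EXTENSION of torus configurations —, the identification of the cell's composite `QjOp` with the NE7c crew's `linCovIter` (127),
# and the operator `Δ_a(U)` of (3.26) WITH `Q := Q(U)` — every operator letter of `G₁ = (Δ₁ + DRD* + aQ*Q)⁻¹` an object of the background

statement-level skeleton of published theorems with citation tags; proofs where landed; nothing here is a claim
about the Yang–Mills mass gap

PDF held: `paper:balaban1985-cmp99-background-propagators` (journal page = PDF page + 388), p. 393; `paper:balaban1985-cmp98-averaging`, pp. 17, 36–37;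
read by this seat (2026-08-21) in the held texts (verbatim quotations in `B7Eq122LinearPartIsLinear`, `B7Prop3GeneralLinear`, `B7TranslationCovariance`).

THE PRINT (verbatim).  [B9] p. 393: *«We are interested in the linear operators Q_j(U). They are compositions of j one-step averaging operators Q_j(U) =
Q(Ū^{j−1})…Q(Ū)Q(U), (3.15) where Q(V) is given by the explicit formula (124) in [5].»*  [B7] p. 17 (1): *«Ω^{(j)} = Ω ∩ L^jηZ^d»*, p. 19: *«Ω^{(j)} may be
replaced by any other lattice»*; (127) p. 37 (as typed in `B7Prop4GeneralLevels.linCovIter`).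

WHY THIS FILE (cell context).  After `B9Eq326OperatorAssembly` (p294817) the only DATA letter of the assembled `Δ_a(U)` besides the number `a` was the
vector averaging `Q`; the tree's `Q(V₀)` (`linQAt`/`linQOp`, E156 p292919) lives on `ℤ^d` (the b07/NE7c carriers).  The torus configurations of the
NE9 chain (`TSite d (L·m)`, `B9Eq319QprimeTorus`) extend PERIODICALLY to `ℤ^d`; reading `Q(V₀)` on the extension at the block corners `L·y` gives
`Q(U)` on the coarse torus — print's «Ω^{(j)} may be replaced by any other lattice».  Hence `Δ_a(U)` with `Q := Q(U)`: an object of `U`, `τ`, `φ`, `a`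
and DISPLAYED structural facts (unit-boundedness and block-contour regularity of the extended background, [B7] (52)).

WHAT IS DEFINED AND PROVED (sorry-free; no `Prop` placeholder; no inequality of the paper).
* §1 periodic extension: `perSite P x` (`x_i mod P_i`), `perCfg A` (bond functions of the torus read on `ℤ^d`), `perCfgLin` (linear),
  `perCfg_apply`, `cornerSite y = L·y`.
* §2 **`QtorusAt … y κ : (Bond d (L·m) → 𝔸) →ₗ[ℂ] 𝔸`** = `L⁻¹ •` (`linQAt` at the corner `L·y` of the extended background ∘ the extension) —
  NORMALISATION: the tree's `linQcov`/`linQAt` is «L(Q(V₀)A)_c» = `L·(Q(V₀)A)_c` (READING C-adv4-22, `L` the block size; cf. `B7Prop3Flat.linQ_eq_smul_Q0form`),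
  so the printed one-step factor `Q(U)` of (3.15) is `L⁻¹` times it (an un-normalised `Q` would mis-weight the `aQ*Q` term of (3.26) by `L²`);
  **`QtorusLin … : (Bond d (L·m) → 𝔸) →ₗ[ℂ] (Bond d m → 𝔸)`** — `Q(U)` of (3.15) ON THE TORUS; `QtorusLin_apply` (= `L⁻¹ • linQcov` of the extensions).
* §3 **`QjOp_apply_eq_linCovIter`** — the cell's UN-NORMALISED composite `B7Eq122LinearPartIsLinear.QjOp … j A` (= `L^j·Q_j(U)A`, the linear part of
  (3.13)) `= B7Prop4GeneralLevels.linCovIter L U A j` (the NE7c crew's (127) object «L^jη·Q_j(U₀)A»): ONE composite averaging in the tree, now also a `LinearMap`.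
* §4 `QtorusW φ …` (the torus `Q(U)` read on the Hilbert fibre and the weighted `L²` spaces) and **`laplaceAofBackground`** := `laplaceAofU` with
  `Q := QtorusW …` — [B9] (3.26) `Δ_a(U)` with NO operator data left (`a` a number; regularity/positivity displayed); `laplaceAofBackground_eq`.
MODEL / DECLARED READINGS.  (M1) torus `TSite d (L·m)` with the periodic extension to the b07 carriers `B7Prop1Explicit.Site d = ℤ^d`; the block of the coarse site `y`
has corner `L·y`; fibre readings as in `B9Eq326OperatorAssembly` (`φ`, `τ`).  (M2) DISPLAYED: `perCfgU U ∈ U1` and `α`-regular block contours ([B7] (52)),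
[B9] Thm 3.11 positivity, `Q` onto (for the vector `Q` — not derived; for `Q′` it is `Qprime_surjective`).  (M3) one level; (3.14) identification as in E156.
HONEST SCOPE.  Bookkeeping (periodic extension) + one identification by `rfl`-induction + assembly; no estimate; NOT summit progress (cell pub-balaban:
NE9 NOT PRINTED / NOT PROVED; spine PROVED 0/9).  Filed by the pub-balaban NE9 BINDER-row owner lineage `b2b-balaban-t4-ne9-p1` (gen 77); NEW file;
nothing modified.  Net new unproved facts: 0.
-/

noncomputable section

open scoped BigOperators InnerProductSpace

namespace Literature.MathematicalPhysics.QuantumFieldTheory.Balaban1983to89.B9Eq315QTorus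

open B4Sect5Torus (TSite)
open B7Prop1Explicit (U1 Wcx boxVec)
open B7Prop2Explicit (avgIter)
open B7Prop3GeneralLinear (linQcov)
open B7Prop4GeneralLevels (linCovIter linCovIter_zero linCovIter_succ)
open B7Eq122LinearPartIsLinear (linQAt linQAt_apply QjOp QjOp_zero QjOp_succ_apply)
open B9Eq319QprimeTorus (fineP)

variable {d : ℕ}

/-! ## §1 Periodic extension of torus configurations to `ℤ^d` -/

section Periodic

variable (P : Fin d → ℕ) [∀ i, NeZero (P i)]

/-- A site of `ℤ^d` read on the torus `Π_i ℤ/P_iℤ` (`x_i mod P_i`). [cite: Balaban1985Averaging, (1) p.17] -/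
def perSite (x : B7Prop1Explicit.Site d) : TSite d P :=
  fun i => ⟨((x i) % (P i : ℤ)).toNat, by
    have hP : (0 : ℤ) < (P i : ℤ) := by exact_mod_cast Nat.pos_of_ne_zero (NeZero.ne (P i))
    have h0 : 0 ≤ x i % (P i : ℤ) := Int.emod_nonneg _ hP.ne'
    have h1 : x i % (P i : ℤ) < (P i : ℤ) := Int.emod_lt_of_pos _ hP
    omega⟩

/-- **The periodic extension of a torus bond function to `ℤ^d`** («Ω^{(j)} may be replaced by any other lattice», [B7] p. 19): `(perCfg A)(x, κ) =
A(x mod P, κ)`. [cite: Balaban1985Averaging, (1) p.17, p.19] -/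
def perCfg {V : Type*} (A : B9SectCLatticeCarrier.Bond d P → V) : B7Prop1Explicit.Site d → Fin d → V := fun x κ => A (perSite P x, κ)

/-- Unfolding. [cite: Balaban1985Averaging, (1) p.17] -/
@[simp] theorem perCfg_apply {V : Type*} (A : B9SectCLatticeCarrier.Bond d P → V) (x : B7Prop1Explicit.Site d) (κ : Fin d) :
    perCfg P A x κ = A (perSite P x, κ) := rfl

/-- The periodic extension is LINEAR in the configuration. [cite: Balaban1985Averaging, (1) p.17] -/
def perCfgLin (V : Type*) [AddCommGroup V] [Module ℂ V] : (B9SectCLatticeCarrier.Bond d P → V) →ₗ[ℂ] (B7Prop1Explicit.Site d → Fin d → V) where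
  toFun := perCfg P
  map_add' _ _ := rfl
  map_smul' _ _ := rfl

/-- Unfolding. [cite: Balaban1985Averaging, (1) p.17] -/
@[simp] theorem perCfgLin_apply {V : Type*} [AddCommGroup V] [Module ℂ V] (A : B9SectCLatticeCarrier.Bond d P → V) :
    perCfgLin P V A = perCfg P A := rfl

end Periodic

/-- The corner `L·y ∈ ℤ^d` of the block of the coarse torus site `y` (the base point `c₋` of the coarse bond `⟨L·y, L·y + Le_κ⟩`).
[cite: Balaban1985Averaging, (2) p.17] -/
def cornerSite (L : ℕ) {m : Fin d → ℕ} (y : TSite d m) : B7Prop1Explicit.Site d := fun i => (L : ℤ) * ((y i : ℕ) : ℤ)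

/-! ## §2 `Q(U)` of (3.15) ON THE TORUS -/

section Qtorus

variable {𝔸 : Type*} [NormedRing 𝔸] [NormedAlgebra ℂ 𝔸] [CompleteSpace 𝔸] [NormOneClass 𝔸]
  (L : ℕ) (m : Fin d → ℕ) [∀ i, NeZero (fineP L m i)] (hL : 1 ≤ L)
  (U : B9SectCLatticeCarrier.Bond d (fineP L m) → 𝔸ˣ) {α : ℝ} (hα1 : α ≤ 1 / 64)
  (hU1 : ∀ (x : B7Prop1Explicit.Site d) (κ : Fin d), perCfg (fineP L m) U x κ ∈ U1 𝔸)
  (hreg : ∀ (y : TSite d m) (κ : Fin d) (r : Fin d → Fin L),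
    ‖((Wcx L (perCfg (fineP L m) U) (cornerSite L y) κ (boxVec L r) : 𝔸ˣ) : 𝔸) - 1‖ ≤ α)

/-- **`(Q(U)A)_c` on the torus** at the coarse bond `c = (y, κ)`: `L⁻¹` times the `ℤ^d` linear part `linQAt` (= «L(Q(V₀)A)_c» = `L·(Q(V₀)A)_c`,
READING C-adv4-22 of [B7] (122) — `L` the block size) of the periodically extended background at the block corner `L·y`, composed with the periodic
extension of `A`; i.e. THE PRINTED one-step factor `Q(U)` of (3.15), correctly normalised. [cite: Balaban1985BackgroundPropagators, (3.15) p.393; Balaban1985Averaging, (122) p.36, (124) p.36] -/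
def QtorusAt (y : TSite d m) (κ : Fin d) : (B9SectCLatticeCarrier.Bond d (fineP L m) → 𝔸) →ₗ[ℂ] 𝔸 :=
  ((L : ℂ))⁻¹ • (linQAt hL (hU1) (cornerSite L y) κ hα1 (hreg y κ) ∘ₗ perCfgLin (fineP L m) 𝔸)

/-- Unfolding: `(Q(U)A)(y, κ) = L⁻¹ · L(Q(Ũ)Ã)_{⟨L·y, L·y+Le_κ⟩}` on the extensions `Ũ`, `Ã` (`linQcov` = «L(Q(V₀)A)_c»). [cite: Balaban1985Averaging, (122) p.36] -/
theorem QtorusAt_apply (y : TSite d m) (κ : Fin d) (A : B9SectCLatticeCarrier.Bond d (fineP L m) → 𝔸) :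
    QtorusAt L m hL U hα1 hU1 hreg y κ A = ((L : ℂ))⁻¹ • linQcov L (perCfg (fineP L m) U) (perCfg (fineP L m) A) (cornerSite L y) κ := rfl

/-- **`Q(U)` ON THE TORUS as a linear map to the coarse bond functions** — the one-step factor of [B9] (3.15) on `T_η`.
[cite: Balaban1985BackgroundPropagators, (3.15) p.393] -/
def QtorusLin : (B9SectCLatticeCarrier.Bond d (fineP L m) → 𝔸) →ₗ[ℂ] (B9SectCLatticeCarrier.Bond d m → 𝔸) :=
  LinearMap.pi fun c => QtorusAt L m hL U hα1 hU1 hreg c.1 c.2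

/-- Unfolding. [cite: Balaban1985BackgroundPropagators, (3.15) p.393] -/
@[simp] theorem QtorusLin_apply (A : B9SectCLatticeCarrier.Bond d (fineP L m) → 𝔸) (c : B9SectCLatticeCarrier.Bond d m) :
    QtorusLin L m hL U hα1 hU1 hreg A c = ((L : ℂ))⁻¹ • linQcov L (perCfg (fineP L m) U) (perCfg (fineP L m) A) (cornerSite L c.1) c.2 := rfl

end Qtorus

/-! ## §3 ONE composite averaging in the tree: `QjOp = linCovIter` ((127)) -/

section Composite

variable {𝔸 : Type*} [NormedRing 𝔸] [NormedAlgebra ℂ 𝔸] [CompleteSpace 𝔸] [NormOneClass 𝔸] {L : ℕ} {U : B7Prop1Explicit.Site d → Fin d → 𝔸ˣ} {α : ℝ}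
  (hL : 1 ≤ L) (hα1 : α ≤ 1 / 64) (hU1 : ∀ (i : ℕ) (x : B7Prop1Explicit.Site d) (κ : Fin d), avgIter L U i x κ ∈ U1 𝔸)
  (hreg : ∀ (i : ℕ) (q : B7Prop1Explicit.Site d) (κ : Fin d) (r : Fin d → Fin L), ‖((Wcx L (avgIter L U i) q κ (boxVec L r) : 𝔸ˣ) : 𝔸) - 1‖ ≤ α)

/-- **The cell's UN-NORMALISED composite `L^j·Q_j(U)` (E156 `QjOp` — the linear part of (3.13), a `LinearMap`; print's `Q_j(U)` of (3.14)–(3.15) is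
`(L^j)⁻¹ •` it, READING C-adv4-22) IS the NE7c crew's (127) object `linCovIter` («L^jη·Q_j(U₀)A», un-normalised likewise)** — same recursion over the
averaged backgrounds `Ū^i`, same rescaling; by induction on `j`. [cite: Balaban1985Averaging, (127) p.37; Balaban1985BackgroundPropagators, (3.15) p.393] -/
theorem QjOp_apply_eq_linCovIter (j : ℕ) (A : B7Prop1Explicit.Site d → Fin d → 𝔸) : QjOp hL hα1 hU1 hreg j A = linCovIter L U A j := by
  induction j with
  | zero => rfl
  | succ j ih =>
    funext z κ
    rw [QjOp_succ_apply, linCovIter_succ, ih]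

end Composite

/-! ## §4 `Δ_a(U)` of (3.26) with `Q := Q(U)`: no operator data left -/

section Assembly

open B9Eq311L2Pairing (WL2)
open B11Eq103H1Complex (BondL2K)
open B9Eq326OperatorAssembly (laplaceAofU)

variable {𝔸 : Type*} [NormedRing 𝔸] [NormedAlgebra ℂ 𝔸] [CompleteSpace 𝔸] [NormOneClass 𝔸]
  (L : ℕ) (m : Fin d → ℕ) [∀ i, NeZero (fineP L m i)] (hL : 1 ≤ L)
  {W : Type*} [NormedAddCommGroup W] [InnerProductSpace ℂ W] (φ : W ≃ₗ[ℂ] 𝔸) {c₀ c₁ : ℝ}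
  (U : B9SectCLatticeCarrier.Bond d (fineP L m) → 𝔸ˣ) {α : ℝ} (hα1 : α ≤ 1 / 64)
  (hU1 : ∀ (x : B7Prop1Explicit.Site d) (κ : Fin d), perCfg (fineP L m) U x κ ∈ U1 𝔸)
  (hreg : ∀ (y : TSite d m) (κ : Fin d) (r : Fin d → Fin L),
    ‖((Wcx L (perCfg (fineP L m) U) (cornerSite L y) κ (boxVec L r) : 𝔸ˣ) : 𝔸) - 1‖ ≤ α)

/-- **`Q(U)` on the weighted `L²` spaces of `W`-valued functions** (fibre read along `φ`; fine bonds weighted by `c₀` (= `η^d`, p. 393 last line),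
coarse bonds by a FREE weight `c₁`).  JUNCTION WITH (3.16) «⟨A, Q*aQA⟩ = Σ_{j=0}^{k} a Σ_{b∈Λ_j} (L^jη)^{d−2} |(Q_j(U)A)(b)|²» (ONE number `a`; weight
`(L^jη)^{d−2}`, the same `d − 2` as in (3.24)): with `Q* := Q†` between these two spaces `⟨A, a•Q†QA⟩_{c₀} = a·c₁·Σ_b ‖(Q(U)A)(b)‖²`, so (3.26)'s `aQ*Q` at
one level IS print's (3.16) iff `c₁ = (Lη)^{d−2}` (or `c₁ = (Lη)^d` with `a ↦ a(Lη)^{−2}`) — reader ne9-leaf-02 g48's pin, adopted.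
[cite: Balaban1985BackgroundPropagators, (3.15)–(3.16) p.393] -/
def QtorusW : BondL2K ℂ d (fineP L m) c₀ W →ₗ[ℂ] BondL2K ℂ d m c₁ W :=
  (WL2.linearEquiv ℂ ℂ (fun _ : B9SectCLatticeCarrier.Bond d m => c₁)).symm.toLinearMap ∘ₗ
    (LinearEquiv.piCongrRight fun _ : B9SectCLatticeCarrier.Bond d m => φ.symm).toLinearMap ∘ₗ
      QtorusLin L m hL U hα1 hU1 hreg ∘ₗ
        (LinearEquiv.piCongrRight fun _ : B9SectCLatticeCarrier.Bond d (fineP L m) => φ).toLinearMap ∘ₗ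
          (WL2.linearEquiv ℂ ℂ (fun _ : B9SectCLatticeCarrier.Bond d (fineP L m) => c₀)).toLinearMap

/-- Unfolding: the coarse value of `QtorusW f` at `c` is `φ⁻¹ (Q(U)(φ ∘ f))(c)`. [cite: Balaban1985BackgroundPropagators, (3.15) p.393] -/
theorem QtorusW_apply (f : BondL2K ℂ d (fineP L m) c₀ W) (c : B9SectCLatticeCarrier.Bond d m) :
    WL2.equiv ℂ _ W (QtorusW L m hL φ U hα1 hU1 hreg (c₁ := c₁) f) c =
      φ.symm (QtorusLin L m hL U hα1 hU1 hreg (fun b => φ (WL2.equiv ℂ _ W f b)) c) := rfl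

variable [NeZero L] [StarRing 𝔸] [StarModule ℂ 𝔸] [FiniteDimensional ℂ W] [Fact (0 < c₀)] [Fact (0 < c₁)] (τ : 𝔸 →ₗ[ℂ] ℂ) (η : ℝ)

/-- **[B9] (3.26) `Δ_a(U)` WITH NO OPERATOR DATA**: `laplaceAofU` at `Q := QtorusW …` — the Hessian `Δ(U)`, the projection `R(U)` onto `Δ_U N(Q′(U))`, the
derivatives `D`/`D*` and the vector averaging `Q(U)` all objects of the background; the number `a` and the DISPLAYED structural facts (unit-bounded,
block-regular extended background) remain. [cite: Balaban1985BackgroundPropagators, (3.26) p.395] -/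
def laplaceAofBackground (a : ℝ) : BondL2K ℂ d (fineP L m) c₀ W →ₗ[ℂ] BondL2K ℂ d (fineP L m) c₀ W :=
  laplaceAofU L m φ η U τ (QtorusW L m hL φ U hα1 hU1 hreg (c₁ := c₁)) a

/-- Unfolding. [cite: Balaban1985BackgroundPropagators, (3.26) p.395] -/
theorem laplaceAofBackground_eq (a : ℝ) :
    laplaceAofBackground L m hL φ U hα1 hU1 hreg τ η (c₀ := c₀) (c₁ := c₁) a =
      laplaceAofU L m φ η U τ (QtorusW L m hL φ U hα1 hU1 hreg (c₁ := c₁)) a :=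
  rfl

end Assembly

end Literature.MathematicalPhysics.QuantumFieldTheory.Balaban1983to89.B9Eq315QTorus

end
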